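import Summits.QuantumFields.YangMills.Theorems.BalabanUVNodesN12GuardedLinAvgRightInverse
import Summits.QuantumFields.YangMills.Theorems.BalabanUVNodesN07LinearisedAveragingKernel

/-!
# BalabanUVNodes ∕ N12 — module F in PRINT's LEFT-FIELD ∕ `Q_k(U₀)` (`dIterL`) CURRENCY: at a guarded near-flat background every `𝔰𝔲(N)`-datum `(W_i·y_i)_i` on the index bonds is
# `Q_{j_i}(U₀)` of a LEFT field `p̂·U₀`, `p̂ = Ad(U₀)(H y)` — the displayed right-inverse letter `hR` of dag-n12-w1's `B15Prop1RightInverseFromLinearisedAveraging.hH_of_dIterL_rightInverse`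
# (INTENT-19) up to its `SU(2)` coordinates and slice

Cell `pub-ymgap` (HUMAN RULINGS D-0062 ∕ D-0149), width seat `pub-ymgap-dag-n10-w1` g2; sequel of module F (`…N12GuardedLinAvgRightInverse`: the (45)–(46) right inverse of
`X ↦ (π(qLin j_i U₀ X c_i))_i` at every `‖↑U₀ − 1‖ < ρ′`).  Key K1⁷ `stmt-QuantumFields-20542`, `--kind proof --supports … --as helper`; count-neutral; THEOREMS ONLY (0 `def`,
0 `sorry`, 0 `instance`, 0 `notation`).  CONSUMED BY NAME, nothing modified: module F (`exists_radius_rightInverse_suProj_qLin`, `exists_letter_of_linear`), n07-w1's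
`Node00.LinearisedAveragingAtBackground` (`qLin`, `dIterL`, ★ `coe_iter_mul_qLin` — `↑Ū^j(U₀)(c)·qLin = Q_j(↑U₀)[b ↦ U₀,b X_b]`) and `BalabanUVNodesN07LinearisedAveragingKernel`
(★ `qLin_mem_lieSU` — `(Q_j(U₀)X)(c) ∈ 𝔰𝔲(N)` under the guard), n07-w2's `Node00.MultiScaleFibreChart` (`coe_suProj_of_mem`), `T4AdjointCovarianceUnitary.specialUnitaryAd` (`Ad(g)X = gXg⋆`).

THE PRINT.  [Balaban1985Variational] Sect. C (44)–(45) p. 285: *«there exists a linear operator H … (45) L^jηQ_jHB = B on Λ_j»* — `Q_j(U₀)` acting on LEFT perturbations `U = exp(iA)·U₀`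
((3) p. 278); n07-w1's `qLin` reads the RIGHT chart `U₀·exp(tX)`; the two are related by the bondwise adjoint action `p̂_b = U₀,b X_b U₀,b⋆` (`p̂·U₀ = U₀·X`).

CONTENTS.  §1 `coe_specialUnitaryAd_mul_coe` (`(Ad(U₀,b)X_b)·U₀,b = U₀,b·X_b`), `leftField_eq_rightField`; §2 ★ `dIterL_leftField_eq_of_suProj_qLin_eq` — under the guard below `j`:
`π(qLin j U₀ X c) = y ⟹ Q_j(↑U₀)[b ↦ (Ad(U₀,b)X_b)·U₀,b](c) = ↑Ū^j(U₀)(c) · ↑y` (membership `qLin_mem_lieSU` drops `π`; `coe_iter_mul_qLin` reads back); §3 ★★★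
`exists_radius_leftField_rightInverse` — module F's uniform theorem in this currency: ONE `ρ′ > 0` (from `k` and the letter constant `B`) such that for EVERY finite index
(levels `≤ k`), EVERY flat right inverse `H₁` with letter `≤ B`, EVERY `U₀` guarded below `k` with `‖↑U₀ − 1‖ < ρ′`: a real-linear `G` with, for all data `y` and indices `i`,
`Q_{j_i}(↑U₀)[b ↦ (Ad(U₀,b)(H₁(G y))_b)·U₀,b](c_i) = ↑Ū^{j_i}(U₀)(c_i) · ↑y_i` — the LEFT field `p̂ := Ad(U₀) ∘ H₁ ∘ G (y)` is `𝔰𝔲(N)`-valued, real-linear in `y`, vanishes at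
every bond where `H₁(G y)` does (axial slices are `Ad`-stable), letter `‖↑(H₁(G y))‖ ≤ 2B‖y‖`; ★ `exists_leftField_rightInverse_of_flat` (one index set, letter-free: the shape
`∀ y, ∃ p̂, ∀ i, Q_{j_i}(↑U₀)[p̂·U₀](c_i) = ↑W_i·↑y_i` of dag-n12-w1's `hR`, with `p̂` 𝔰𝔲(N)-valued).

HONEST FRAMING.  Junction bookkeeping by name; the flat right inverse `H₁` stays DISPLAYED here (module F′ `…GuardedLinAvgRightInverseAdm22` discharges it on the index bonds of
admissible families at the record); the `SU(2)` coordinates `Σ_a p_{b,a}E_a` and the slice membership `cplxVec p ∈ S` of dag-n12-w1's letter are NOT produced here (the slice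
is the consumer's: `p̂` inherits the support of `H₁`'s range); `ρ′` EXISTS by module D∕E's smoothness constants, print's `O(L²α₀)` radius NOT claimed; nothing of Bałaban's analysis
asserted; N12 ∕ N07 NOT discharged; K1⁷ NOT closed; count-neutral (typed 28∕28 · discharged 5∕27 unmoved); one finite 𝕋⁴ programme at fixed ε — R4 closes the conditional rung
`BalabanLadder.UV` only; the YM mass gap (Clay) is NOT proved by any of this.  No `sorry`, no `def`, no `instance`, no `notation`.
-/

noncomputable section

open scoped BigOperators Matrix.Norms.L2Operator

namespace Summit.QuantumFields.YangMills.BalabanUVNodes.N12GuardedLinAvgRightInverseLeft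

open Literature.MathematicalPhysics.QuantumFieldTheory.Balaban1983to89
open BlockAveraging (blockAvg)
open ExpMeanLog (expMeanLogSU)
open T4AdjointCovarianceUnitary (lieSU specialUnitaryAd coe_specialUnitaryAd)
open Node00
open Summit.QuantumFields.YangMills.BalabanUVNodes.N07LinearisedAveragingKernel (qLin_mem_lieSU)
open Summit.QuantumFields.YangMills.BalabanUVNodes.N12GuardedLinAvgRightInverse (exists_radius_rightInverse_suProj_qLin exists_letter_of_linear)

variable {P : Params} {N : ℕ} [NeZero N]

/-! ## §1  Left field `p̂·U₀` versus right field `U₀·X`: `p̂ = Ad(U₀)X` bondwise -/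

omit [NeZero N] in
/-- `(Ad(g)X)·g = g·X` for `g ∈ SU(N)` (`Ad(g)X = gXg⋆`, `g⋆g = 1`). [cite: Balaban1985Variational, (3) p.278 (bookkeeping)] -/
theorem coe_specialUnitaryAd_mul_coe (g : SU N) (X : lieSU (Fin N)) :
    ((specialUnitaryAd g X : lieSU (Fin N)) : Matrix (Fin N) (Fin N) ℂ) * (g : Matrix (Fin N) (Fin N) ℂ) = (g : Matrix (Fin N) (Fin N) ℂ) * (X : Matrix (Fin N) (Fin N) ℂ) := by
  rw [coe_specialUnitaryAd, mul_assoc, Unitary.star_mul_self_of_mem (Matrix.specialUnitaryGroup_le_unitaryGroup g.2), mul_one]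

omit [NeZero N] in
/-- The LEFT field of `p̂ := Ad(U₀)X` is the RIGHT field of `X`: `(b ↦ p̂_b·U₀,b) = (b ↦ U₀,b·X_b)`. [cite: Balaban1985Variational, (3) p.278 (bookkeeping)] -/
theorem leftField_eq_rightField (U₀ : GaugeField P 0 (SU N)) (X : PBond P 0 → lieSU (Fin N)) :
    (fun b => ((specialUnitaryAd (U₀ b) (X b) : lieSU (Fin N)) : Matrix (Fin N) (Fin N) ℂ) * (U₀ b : Matrix (Fin N) (Fin N) ℂ)) =
      fun b => (U₀ b : Matrix (Fin N) (Fin N) ℂ) * (X b : Matrix (Fin N) (Fin N) ℂ) :=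
  funext fun b => coe_specialUnitaryAd_mul_coe (U₀ b) (X b)

/-! ## §2  From `π(qLin j U₀ X c) = y` to `Q_j(↑U₀)[p̂·U₀](c) = ↑Ū^j(U₀)(c)·↑y` under the guard -/

/-- ★ **LEFT-FIELD READING OF A RIGHT-INVERSE IDENTITY**: under the guard below `j`, `π(qLin j U₀ X c) = y` gives `Q_j(↑U₀)[b ↦ (Ad(U₀,b)X_b)·U₀,b](c) = ↑Ū^j(U₀)(c) · ↑y`
(`qLin j U₀ X c ∈ 𝔰𝔲(N)` by n07-w1's `qLin_mem_lieSU`, so `π` drops; `coe_iter_mul_qLin` reads the left-trivialised `qLin` back to `Q_j = dIterL`). [cite: Balaban1985Variational, (44)-(45) p.285] -/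
theorem dIterL_leftField_eq_of_suProj_qLin_eq {j : ℕ} {U₀ : GaugeField P 0 (SU N)} (hsb : SmallBelow (fun j => blockAvg (P := P) (j := j) expMeanLogSU) j U₀)
    (X : PBond P 0 → lieSU (Fin N)) (c : PBond P j) {y : lieSU (Fin N)} (h : suProj N (qLin j U₀ X c) = y) :
    dIterL j (coeField U₀) (fun b => ((specialUnitaryAd (U₀ b) (X b) : lieSU (Fin N)) : Matrix (Fin N) (Fin N) ℂ) * (U₀ b : Matrix (Fin N) (Fin N) ℂ)) c =
      ((Averaging.iter (fun j => blockAvg (P := P) (j := j) expMeanLogSU) j U₀ c : SU N) : Matrix (Fin N) (Fin N) ℂ) * (y : Matrix (Fin N) (Fin N) ℂ) := by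
  have hq : qLin j U₀ X c = (y : Matrix (Fin N) (Fin N) ℂ) := by
    rw [← h, coe_suProj_of_mem (qLin_mem_lieSU hsb X c)]
  rw [leftField_eq_rightField, ← coe_iter_mul_qLin hsb X c, hq]

/-! ## §3  Module F in the left-field currency -/

/-- ★★★ **ONE RADIUS, LEFT-FIELD CURRENCY**: for levels `≤ k` and a letter constant `B ≥ 0` there is `ρ′ > 0` (module F's, from `k` and `B` only) such that for EVERY finite index
(`lv i ≤ k`, bonds `bd i`), EVERY real-linear flat right inverse `H₁` (`π(qLin (lv i) 1 (H₁ y) (bd i)) = y i`) with letter `‖↑(H₁ y)‖ ≤ B‖y‖`, and EVERY background `U₀` guarded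
below `k` with `‖↑U₀ − 1‖ < ρ′`: a real-linear `G` (`‖G y‖ ≤ 2‖y‖`) such that the LEFT field `p̂ := Ad(U₀)(H₁(G y))` solves print's (45) at `U₀` for every datum `y`:
`Q_{lv i}(↑U₀)[b ↦ p̂_b·U₀,b](bd i) = ↑Ū^{lv i}(U₀)(bd i) · ↑y_i`, with the letter `‖↑(H₁(G y))‖ ≤ 2B‖y‖`. [cite: Balaban1985Variational, (44)-(46) p.285; Balaban1985Averaging, Prop. 3 (121)-(125) p.36] -/
theorem exists_radius_leftField_rightInverse (k : ℕ) {B : ℝ} (hB0 : 0 ≤ B) :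
    ∃ ρ' : ℝ, 0 < ρ' ∧ ∀ {ι : Type*} [Fintype ι] (lv : ι → ℕ) (_ : ∀ i, lv i ≤ k) (bd : (i : ι) → PBond P (lv i))
      (H₁ : (ι → lieSU (Fin N)) →ₗ[ℝ] (PBond P 0 → lieSU (Fin N)))
      (_ : ∀ y i, suProj N (qLin (lv i) (1 : GaugeField P 0 (SU N)) (H₁ y) (bd i)) = y i)
      (_ : ∀ y, ‖(fun b => (H₁ y b : Matrix (Fin N) (Fin N) ℂ))‖ ≤ B * ‖y‖)
      (U₀ : GaugeField P 0 (SU N)), SmallBelow (fun j => blockAvg (P := P) (j := j) expMeanLogSU) k U₀ → ‖coeField U₀ - 1‖ < ρ' →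
      ∃ G : (ι → lieSU (Fin N)) →ₗ[ℝ] (ι → lieSU (Fin N)),
        (∀ y i, dIterL (lv i) (coeField U₀)
            (fun b => ((specialUnitaryAd (U₀ b) (H₁ (G y) b) : lieSU (Fin N)) : Matrix (Fin N) (Fin N) ℂ) * (U₀ b : Matrix (Fin N) (Fin N) ℂ)) (bd i) =
          ((Averaging.iter (fun j => blockAvg (P := P) (j := j) expMeanLogSU) (lv i) U₀ (bd i) : SU N) : Matrix (Fin N) (Fin N) ℂ) * (y i : Matrix (Fin N) (Fin N) ℂ)) ∧
        (∀ y, ‖G y‖ ≤ 2 * ‖y‖) ∧ ∀ y, ‖(fun b => (H₁ (G y) b : Matrix (Fin N) (Fin N) ℂ))‖ ≤ 2 * B * ‖y‖ := by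
  obtain ⟨ρ', hρ', h⟩ := exists_radius_rightInverse_suProj_qLin (P := P) (N := N) k hB0
  refine ⟨ρ', hρ', fun {ι} _ lv hlv bd H₁ h₁ hB U₀ hsb hU => ?_⟩
  obtain ⟨G, hG, hGn, hHB⟩ := h lv hlv bd H₁ h₁ hB U₀ hU
  exact ⟨G, fun y i => dIterL_leftField_eq_of_suProj_qLin_eq (hsb.mono (hlv i)) (H₁ (G y)) (bd i) (hG y i), hGn, hHB⟩

/-- ★ **THE `hR`-SHAPE AT A GUARDED NEAR-FLAT BACKGROUND** (one index set, letter-free): a real-linear flat right inverse `H₁` gives `ρ′ > 0` such that at every `U₀` guarded below `k`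
with `‖↑U₀ − 1‖ < ρ′`: for EVERY datum `y` there is an `𝔰𝔲(N)`-valued LEFT field `p̂` (namely `Ad(U₀)(H₁(G y))`, vanishing wherever `H₁(G y)` does) with
`Q_{lv i}(↑U₀)[b ↦ p̂_b·U₀,b](bd i) = ↑Ū^{lv i}(U₀)(bd i) · ↑y_i` for all `i` — dag-n12-w1's displayed `hR` up to its `SU(2)` coordinates and slice. [cite: Balaban1985Variational, (44)-(45) p.285] -/
theorem exists_leftField_rightInverse_of_flat (k : ℕ) {ι : Type*} [Fintype ι] (lv : ι → ℕ) (hlv : ∀ i, lv i ≤ k) (bd : (i : ι) → PBond P (lv i))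
    (H₁ : (ι → lieSU (Fin N)) →ₗ[ℝ] (PBond P 0 → lieSU (Fin N)))
    (h₁ : ∀ y i, suProj N (qLin (lv i) (1 : GaugeField P 0 (SU N)) (H₁ y) (bd i)) = y i) :
    ∃ ρ' : ℝ, 0 < ρ' ∧ ∀ U₀ : GaugeField P 0 (SU N), SmallBelow (fun j => blockAvg (P := P) (j := j) expMeanLogSU) k U₀ → ‖coeField U₀ - 1‖ < ρ' →
      ∀ y : ι → lieSU (Fin N), ∃ p : PBond P 0 → lieSU (Fin N),
        (∃ G : (ι → lieSU (Fin N)) →ₗ[ℝ] (ι → lieSU (Fin N)), ∀ b, p b = specialUnitaryAd (U₀ b) (H₁ (G y) b)) ∧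
        ∀ i, dIterL (lv i) (coeField U₀) (fun b => (p b : Matrix (Fin N) (Fin N) ℂ) * (U₀ b : Matrix (Fin N) (Fin N) ℂ)) (bd i) =
          ((Averaging.iter (fun j => blockAvg (P := P) (j := j) expMeanLogSU) (lv i) U₀ (bd i) : SU N) : Matrix (Fin N) (Fin N) ℂ) * (y i : Matrix (Fin N) (Fin N) ℂ) := by
  obtain ⟨B, hB0, hB⟩ := exists_letter_of_linear (P := P) (N := N) H₁
  obtain ⟨ρ', hρ', h⟩ := exists_radius_leftField_rightInverse (P := P) (N := N) k hB0
  refine ⟨ρ', hρ', fun U₀ hsb hU y => ?_⟩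
  obtain ⟨G, hG, -, -⟩ := h lv hlv bd H₁ h₁ hB U₀ hsb hU
  exact ⟨fun b => specialUnitaryAd (U₀ b) (H₁ (G y) b), ⟨G, fun _ => rfl⟩, fun i => hG y i⟩

end Summit.QuantumFields.YangMills.BalabanUVNodes.N12GuardedLinAvgRightInverseLeft

end
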